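import Summits.AtomisticToContinuum.FouriersLaw.Theorems.BondHeatUncertaintySubdiffusiveBondHeatJunctionRatioRootContactFrames

/-!
# `JunctionRatioFirstBondTransfer` — file 19: the GRADE-½ CONTACT LAW AT DEPTH TWO as a TYPED LINE
# «first-order response data ∧ first-order entropy production ∧ FIRST-BOND TRANSFER ⟹ RootThermalisation 1»
# (cell `decomp-a2c`, lens-1 «grading / quantitative ladder», gen 63; beneath files 18a/18b `…JunctionRatioRootContact[Frames]`; target 11071)

Files 18a/18b re-graded the contact side condition of the peeled door of 11071 from exact positivity [NFO_d] to the ROOT laws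
`RootPositivity d` [RP_d] ⟸ `RootThermalisation d` [RT_d] (`|(T + δ/2) − ⟨p_d²⟩| ≤ δ·(C·√E_N + ε)` and mirror; `d = 0` PROVED) and named the
attack for `d = 1`: LINEAR HYPOELLIPTIC TRANSFER OF THE BOUNDARY ENTROPY PRODUCTION.  This file TYPES that attack as a line of three pieces over
FIRST-ORDER RESPONSE DATA of the `N`-chain at temperature `T` (`μ₀ = gibbsMeasure N T`, steady states `μ` at `(T + δ/2, T − δ/2)`, `δ ↓ 0`):

* `IsResponseDensityAt … N h` — `h ∈ L²(μ₀)` and `∫F dμ = ∫F dμ₀ + δ∫F·h dμ₀ + o(δ)` for `F ∈ C_c^∞`, uniformly over steady states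
  (ε–δ form of the route notion `OddSectorIrreversibility.ResponseDensity`, stmt-9144 PROVED); INHABITED: `exists_responseDensityAt` (PROVED here from
  `responseDensity_holds`, weak-NESS uniqueness `bondHeatUncertainty_nessUnique_holds` and `pinnedChain_isSteadyState_gibbsMeasure`).
* `IsTapScoreAt … N b a h g` — `g ∈ L²(μ₀)` and `∂_{p_b} h = g + a·p_b` weakly in `L²(μ₀)` (test functions `C_c^∞`, `μ₀`-adjoint
  `∂*_{p_b} = −∂_{p_b} + p_b/T`).  The TAP SCORES are `g₀ := ∂_{p₀}h − p₀/(2T²)` (`b = 0`, `a = 1/(2T²)`) and `g_{N−1} := ∂_{p_{N−1}}h + p_{N−1}/(2T²)`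
  (`a = −1/(2T²)`): to first order `∂_{p₀} log(ρ_δ/m_{T_L}) = δ·g₀`, so `δ²‖g₀‖²` is the relative Fisher information of the steady state w.r.t. the hot
  Maxwellian — entropy production in CURRENT currency.
* `IsMomentCoefficientAt … N i τ` — `⟨p_i²⟩_μ = T + δ·τ + o(δ)` uniformly over steady states.  CALIBRATED at the contact sites (PROVED from 17b
  `contactDrop_firstOrder`): `τ₀ = ½ − E_N` (`isMomentCoefficientAt_zero`), `τ_{N−1} = E_N − ½` (`isMomentCoefficientAt_last`).

Pieces (§C; per temperature `…At`, global in §D):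
* [RR] `ResponseRegularityAt … N` (`N ≥ 3`): the response density has tap scores in `L²(μ₀)` at both bath sites and the depth-two moment
  coefficients `τ₁`, `τ_{N−2}` exist.  FIXED-`N` REGULARITY · KNOWN-type (hypoelliptic smoothness and Gaussian-type tails of the first-order
  response, Hairer–Majda 2009 / EPR-B 1999 / CEHR 2018 (2.5)); the `h`-component is PROVED (`exists_responseDensityAt`). [support · known]
* [EP] `EntropyProductionAt … N` (`N ≥ 2`): `T³·(‖g₀‖² + ‖g_{N−1}‖²) ≤ E_N` for every response density and tap scores — FIRST-ORDER ENTROPY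
  PRODUCTION BOUND (identity in fact: entropy balance `γ(T_L·I_L + T_R·I_R) = J·(1/T_R − 1/T_L)` at order `δ²` with `J = γδE_N + o(δ)`; equivalently
  the energy identity of the linearised stationarity equation `L†h = (γ/2T²)(p²_{N−1} − p₀²)` tested against `h`:
  `‖∂_{p₀}h‖² + ‖∂_{p_{N−1}}h‖² = (1 − 2E_N)/(2T³)`).  FIXED-`N` · KNOWN-type · harmonic-TRUE to `10⁻¹⁰` (g62 `calib/bracket_check.py` (EP),(II)). [support · known]
* [FB] `FirstBondTransferAt … C`: `∃ N₂ ∀ N ≥ N₂`: `|½ − τ₁| ≤ C·√(T³‖g₀‖²)` and `|½ + τ_{N−2}| ≤ C·√(T³‖g_{N−1}‖²)` for every response density,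
  tap scores and depth-two coefficients — THE FIRST-BOND TRANSFER: the first-order temperature drop over the first bond is controlled by the hot
  tap score, with an `N`-UNIFORM constant.  Mechanism (file 18a docstring (S1)–(S4)): `w := h − H/(2T²)` solves `L†w = (γ/T²)(p²_{N−1} − T)` (source
  at the cold end only); `∂_{p₀}`, `∂_{q₀}` commute past `L†` up to `[∂_{p₀}, L†] = −∂_{q₀} − γ∂_{p₀}`, `[∂_{q₀}, L†] = (U″ + V″)∂_{p₀} − V″(r₀)∂_{p₁}`,
  giving `∂_{q₀}w = (L† − γ)g₀`, `V″(r₀)∂_{p₁}w = L†∂_{q₀}w + (U″ + V″)g₀` (`N ≥ 3`), hence the BRACKET IDENTITY `(τ₁ − ½)/T = ⟨p₁, ∂_{p₁}w⟩₀ = ⟨Ψ, g₀⟩₀`,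
  `Ψ := (L − γ)Lψ + (U″(q₀) + V″(r₀))ψ`, `ψ := p₁/V″(r₀)` — a LOCAL polynomial observable of sites `0…3`, so `C = sup_N ‖Ψ‖_{L²(μ₀^N)}/√T < ∞` by the
  uniform log-concavity of `μ₀` (`U″ ≥ ω₂`, `V″ ≥ 1`; Brascamp–Lieb).  Harmonic check: identity to `10⁻¹²`, ratio `|φ₁|/(‖Ψ‖√(E/T)) ∈ [0.42, 0.70]`
  (g62 `calib/out-bracket.txt`).  `N`-UNIFORM · UNDECIDED · ATTACKABLE · INSTRUMENTABLE · harmonic-TRUE; strictly WEAKER than the identity (only the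
  Cauchy–Schwarz shadow is asked) and INDEPENDENT of 11071 (a fixed-depth statement; all `N → ∞` content of the door stays in [PBL]). [interface of the line]
  HONESTY NOTE: modulo the fixed-`N` facts ([EP] is an identity and hot/cold reflection gives `‖g₀‖² = ‖g_{N−1}‖² = E_N/(2T³)`) the bare inequality
  [FB](C) is [RT_1] at first order with constant `C/√2` — an INTERFACE, not yet a reduction.  The reduction is file 19b
  `…JunctionRatioFirstBondBracket`: the EXPLICIT observable `Ψ` (`transferObservable`, built from the Literature `generator`), the bracket identity
  [BI] `τ₁ − ½ = T⟨Ψ, g₀⟩₀` (fixed `N`) and the `N`-uniform equilibrium moment [LM] `sup_N ‖Ψ‖_{L²(μ₀^N)} < ∞`, with `BI ∧ LM ⟹ FB` PROVED there.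

Composition (PROVED, §D): `rootThermalisationAt_one_of_transfer : (∀ N, RR_N) ∧ (∀ N, EP_N) ∧ FB(C) ⟹ RootThermalisationAt … (max C 0) 1`
(`√` is monotone: `T³‖g₀‖² ≤ T³(‖g₀‖² + ‖g_{N−1}‖²) ≤ E_N`; then `(T + δ/2) − ⟨p₁²⟩ = δ(½ − τ₁) − (⟨p₁²⟩ − T − δτ₁)`), and by name
`rootThermalisation_one_of_transfer`, `rootPositivity_one_of_transfer` (file 18b `rootPositivity_of_rootThermalisation`),
`asymptoticSeriesLaw_of_transfer_of_peeled_of_escapeInfZero` and `boundedResponse_of_transfer_of_peeled_of_escapeInfZero_of_subOhmicBootstrap`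
(11071 BY NAME: `ResponseRegularity ∧ FirstOrderEntropyProduction ∧ FirstBondTransfer ∧ (∀ ρ < 1, PeeledLocalityLaw ρ 1) ∧ EscapeInfZero ∧ SubOhmicBootstrap
⟹ BoundedResponse`, through file 18b's four-piece node at `d = 1`).  NET EFFECT: the contact leaf [RP_1] of the node of record is now a LINE with one
`N`-uniform crux [FB] (a Cauchy–Schwarz-type transfer inequality with a named local test observable) and two fixed-`N` known-type supports.
No `sorry`; standard axioms; imports only file 18b.
-/

noncomputable section

open MeasureTheory Filter Topology Set
open scoped BigOperators

namespace Summit.AtomisticToContinuum.FouriersLaw.Theorems.SubdiffusiveBondHeat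

namespace EscapeGrading

open Literature.MathematicalPhysics.KineticTheory.HeatConduction
open Summit.AtomisticToContinuum.FouriersLaw.Theses.BondHeatUncertainty (BoundedResponse NonBallistic)
open Summit.AtomisticToContinuum.FouriersLaw.Theorems.SubdiffusiveBondHeat.JunctionDefectGrading

/-! ## A. First-order response data of the `N`-chain at temperature `T` (fixed `N`) -/

/-- **Response density** `h` of the steady states at `(T + δ/2, T − δ/2)`, `δ ↓ 0`, relative to `μ₀ = gibbsMeasure N T`: `h ∈ L²(μ₀)` and for every
`F ∈ C_c^∞`, `∀ ε > 0 ∃ δ₀ > 0 ∀ δ ∈ (0, δ₀)`, every steady state `μ`: `|∫F dμ − ∫F dμ₀ − δ·∫F·h dμ₀| ≤ δ·ε`.  Inhabited (`exists_responseDensityAt`);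
`μ₀`-a.e. unique. [notion · first-order data] -/
def IsResponseDensityAt (ω₂ lam β γ T : ℝ) (N : ℕ) (h : PhaseSpace N → ℝ) : Prop :=
  MemLp h 2 ((pinnedChain ω₂ lam β γ).gibbsMeasure N T) ∧
  ∀ F : PhaseSpace N → ℝ, ContDiff ℝ ((⊤ : ℕ∞) : WithTop ℕ∞) F → HasCompactSupport F →
    ∀ ε : ℝ, 0 < ε → ∃ δ₀ : ℝ, 0 < δ₀ ∧ ∀ δ : ℝ, 0 < δ → δ < δ₀ →
      ∀ μ : Measure (PhaseSpace N), (pinnedChain ω₂ lam β γ).IsSteadyState N (T + δ / 2) (T - δ / 2) μ →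
        |(∫ x, F x ∂μ) - (∫ x, F x ∂((pinnedChain ω₂ lam β γ).gibbsMeasure N T))
            - δ * ∫ x, F x * h x ∂((pinnedChain ω₂ lam β γ).gibbsMeasure N T)| ≤ δ * ε

/-- **Tap score** `g` of `h` at bath site `b` with shift `a`: `g ∈ L²(μ₀)` and `∂_{p_b} h = g + a·p_b` weakly in `L²(μ₀)` —
`∫ (g + a·p_b)·φ dμ₀ = ∫ h·(p_b φ/T − ∂_{p_b}φ) dμ₀` for all `φ ∈ C_c^∞` (`−∂_{p_b} + p_b/T` is the `L²(μ₀)`-adjoint of `∂_{p_b}`).  Hot tap: `b = 0`,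
`a = 1/(2T²)` (`g₀ = ∂_{p₀}h − p₀/(2T²)`); cold tap: `b = N − 1`, `a = −1/(2T²)`.  `μ₀`-a.e. unique given `h`. [notion · first-order data] -/
def IsTapScoreAt (ω₂ lam β γ T : ℝ) (N : ℕ) (b : Fin N) (a : ℝ) (h g : PhaseSpace N → ℝ) : Prop :=
  MemLp g 2 ((pinnedChain ω₂ lam β γ).gibbsMeasure N T) ∧
  ∀ φ : PhaseSpace N → ℝ, ContDiff ℝ ((⊤ : ℕ∞) : WithTop ℕ∞) φ → HasCompactSupport φ →
    ∫ x, (g x + a * x.2 b) * φ x ∂((pinnedChain ω₂ lam β γ).gibbsMeasure N T) =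
      ∫ x, h x * (x.2 b / T * φ x - partialP b φ x) ∂((pinnedChain ω₂ lam β γ).gibbsMeasure N T)

/-- **Moment coefficient** `τ` of site `i`: `⟨p_i²⟩_μ = T + δ·τ + o(δ)` uniformly over steady states — `∀ ε > 0 ∃ δ₀ > 0 ∀ δ ∈ (0, δ₀)`, every steady
state `μ` at `(T + δ/2, T − δ/2)`: `|⟨p_i²⟩_μ − T − δ·τ| ≤ δ·ε`.  Unique if it exists; `τ₀ = ½ − E_N`, `τ_{N−1} = E_N − ½` (§B). [notion · first-order data] -/
def IsMomentCoefficientAt (ω₂ lam β γ T : ℝ) (N : ℕ) (i : Fin N) (τ : ℝ) : Prop :=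
  ∀ ε : ℝ, 0 < ε → ∃ δ₀ : ℝ, 0 < δ₀ ∧ ∀ δ : ℝ, 0 < δ → δ < δ₀ →
    ∀ μ : Measure (PhaseSpace N), (pinnedChain ω₂ lam β γ).IsSteadyState N (T + δ / 2) (T - δ / 2) μ →
      |(∫ x, x.2 i ^ 2 ∂μ) - T - δ * τ| ≤ δ * ε

/-! ## B. What the tree already gives: the response density exists; the contact coefficients -/

/-- **The response density exists** (every `N`, `T > 0`): item 9144 `ResponseDensity` (`responseDensity_holds`) along the canonical steady family,
transported to every steady state by weak-NESS uniqueness (`bondHeatUncertainty_nessUnique_holds`) and to `μ₀ = gibbsMeasure N T` by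
`pinnedChain_isSteadyState_gibbsMeasure`; `Tendsto` along `𝓝[≠] 0` specialised to `δ ↓ 0`. [this file] -/
theorem exists_responseDensityAt {ω₂ lam β γ T : ℝ} (hω : 0 < ω₂) (hl : 0 < lam) (hβ : 0 < β) (hγ : 0 < γ) (hT : 0 < T) (N : ℕ) :
    ∃ h : PhaseSpace N → ℝ, IsResponseDensityAt ω₂ lam β γ T N h := by
  have huniq := bondHeatUncertainty_nessUnique_holds ω₂ lam β γ hω hl hβ hγ
  obtain ⟨μf, hμf, -⟩ := exists_canonical_response hω hl hβ hγ hT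
  obtain ⟨h, hh2, hF, -⟩ :=
    Summit.AtomisticToContinuum.FouriersLaw.Theorems.OddSectorIrreversibility.Corrector.responseDensity_holds
      ω₂ lam β γ hω hl hβ hγ huniq μf hμf T hT N
  have hG : μf N T T = (pinnedChain ω₂ lam β γ).gibbsMeasure N T :=
    huniq N T T hT hT _ _ (hμf N T T hT hT) (pinnedChain_isSteadyState_gibbsMeasure hω hl.le hβ.le γ N hT)
  rw [hG] at hh2
  refine ⟨h, hh2, fun F hFs hFc ε hε => ?_⟩
  have hlim := hF F hFs hFc
  rw [hG] at hlim
  obtain ⟨δ₁, hδ₁, hδ₁'⟩ := Metric.tendsto_nhdsWithin_nhds.1 hlim ε hε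
  refine ⟨min δ₁ T, lt_min hδ₁ hT, fun δ hδ hδlt μ hμ => ?_⟩
  have hδ1 : δ < δ₁ := lt_of_lt_of_le hδlt (min_le_left _ _)
  have hδT : δ < T := lt_of_lt_of_le hδlt (min_le_right _ _)
  have hTL : 0 < T + δ / 2 := by linarith
  have hTR : 0 < T - δ / 2 := by linarith
  have hμeq : μ = μf N (T + δ / 2) (T - δ / 2) := huniq N _ _ hTL hTR μ _ hμ (hμf N _ _ hTL hTR)
  have hmem : δ ∈ ({0}ᶜ : Set ℝ) := by simp [hδ.ne']
  have hdd : dist δ 0 < δ₁ := by rw [Real.dist_eq, sub_zero, abs_of_pos hδ]; exact hδ1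
  have hdist := hδ₁' hmem hdd
  rw [← hμeq, Real.dist_eq] at hdist
  set A := (∫ x, F x ∂μ) - ∫ x, F x ∂((pinnedChain ω₂ lam β γ).gibbsMeasure N T) with hA
  set L := ∫ x, F x * h x ∂((pinnedChain ω₂ lam β γ).gibbsMeasure N T) with hL
  have e : A - δ * L = δ * (A / δ - L) := by field_simp
  rw [e, abs_mul, abs_of_pos hδ]
  exact mul_le_mul_of_nonneg_left hdist.le hδ.le

/-- **`τ₀ = ½ − E_N`** (`N ≥ 2`): the hot contact site's coefficient, from `contactDrop_firstOrder` (file 17b). [this file] -/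
theorem isMomentCoefficientAt_zero {ω₂ lam β γ T : ℝ} (hω : 0 < ω₂) (hl : 0 < lam) (hβ : 0 < β) (hγ : 0 < γ) (hT : 0 < T)
    {N : ℕ} (hN : 2 ≤ N) : IsMomentCoefficientAt ω₂ lam β γ T N ⟨0, by omega⟩ (1 / 2 - escapeDeficit ω₂ lam β γ T N) := by
  intro ε hε
  obtain ⟨δ₀, hδ₀, h⟩ := contactDrop_firstOrder hω hl hβ hγ hT hN hε
  refine ⟨δ₀, hδ₀, fun δ hδ hδlt μ hμ => ?_⟩
  obtain ⟨habs, -⟩ := h δ hδ hδlt μ hμ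
  rw [abs_le] at habs ⊢
  constructor <;> linarith [habs.1, habs.2]

/-- **`τ_{N−1} = E_N − ½`** (`N ≥ 2`): the cold contact site's coefficient (mirror clause of `contactDrop_firstOrder`). [this file] -/
theorem isMomentCoefficientAt_last {ω₂ lam β γ T : ℝ} (hω : 0 < ω₂) (hl : 0 < lam) (hβ : 0 < β) (hγ : 0 < γ) (hT : 0 < T)
    {N : ℕ} (hN : 2 ≤ N) : IsMomentCoefficientAt ω₂ lam β γ T N ⟨N - 1, by omega⟩ (escapeDeficit ω₂ lam β γ T N - 1 / 2) := by
  intro ε hε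
  obtain ⟨δ₀, hδ₀, h⟩ := contactDrop_firstOrder hω hl hβ hγ hT hN hε
  refine ⟨δ₀, hδ₀, fun δ hδ hδlt μ hμ => ?_⟩
  obtain ⟨habs, hends⟩ := h δ hδ hδlt μ hμ
  have e : (∫ x, x.2 ⟨N - 1, by omega⟩ ^ 2 ∂μ) - T - δ * (escapeDeficit ω₂ lam β γ T N - 1 / 2)
      = ((T + δ / 2) - ∫ x, x.2 ⟨0, by omega⟩ ^ 2 ∂μ) - δ * escapeDeficit ω₂ lam β γ T N := by
    linarith [hends]
  rw [e]
  exact habs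

/-! ## C. The pieces of the line -/

/-- **[RR] Response regularity at depth two** (`N ≥ 3`): there are a response density `h`, hot and cold tap scores `g₀`, `g_{N−1}` in `L²(μ₀)` and
depth-two moment coefficients `τ₁`, `τ_{N−2}`.  FIXED-`N` · KNOWN-type (hypoelliptic regularity and Gaussian-type tails of the first-order response;
the `h`-component is `exists_responseDensityAt`). [support · known · fixed N] -/
def ResponseRegularityAt (ω₂ lam β γ T : ℝ) (N : ℕ) : Prop :=
  ∀ (_hN : 3 ≤ N), ∃ h g₀ g₁ : PhaseSpace N → ℝ, ∃ τ τ' : ℝ,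
    IsResponseDensityAt ω₂ lam β γ T N h ∧
    IsTapScoreAt ω₂ lam β γ T N ⟨0, by omega⟩ (1 / (2 * T ^ 2)) h g₀ ∧
    IsTapScoreAt ω₂ lam β γ T N ⟨N - 1, by omega⟩ (-(1 / (2 * T ^ 2))) h g₁ ∧
    IsMomentCoefficientAt ω₂ lam β γ T N ⟨1, by omega⟩ τ ∧
    IsMomentCoefficientAt ω₂ lam β γ T N ⟨N - 1 - 1, by omega⟩ τ'

/-- **[EP] First-order entropy production bound** (`N ≥ 2`): `T³·(‖g₀‖² + ‖g_{N−1}‖²) ≤ E_N` for every response density and tap scores — the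
entropy balance `γ(T_L I_L + T_R I_R) = J(1/T_R − 1/T_L)` at order `δ²` (`I_L = δ²‖g₀‖² + o(δ²)`, `J = γδE_N + o(δ)`); an identity in fact.
FIXED-`N` · KNOWN-type · harmonic-TRUE. [support · known · fixed N] -/
def EntropyProductionAt (ω₂ lam β γ T : ℝ) (N : ℕ) : Prop :=
  ∀ (_hN : 2 ≤ N), ∀ h g₀ g₁ : PhaseSpace N → ℝ,
    IsResponseDensityAt ω₂ lam β γ T N h →
    IsTapScoreAt ω₂ lam β γ T N ⟨0, by omega⟩ (1 / (2 * T ^ 2)) h g₀ →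
    IsTapScoreAt ω₂ lam β γ T N ⟨N - 1, by omega⟩ (-(1 / (2 * T ^ 2))) h g₁ →
      T ^ 3 * ((∫ x, g₀ x ^ 2 ∂((pinnedChain ω₂ lam β γ).gibbsMeasure N T)) +
          ∫ x, g₁ x ^ 2 ∂((pinnedChain ω₂ lam β γ).gibbsMeasure N T)) ≤ escapeDeficit ω₂ lam β γ T N

/-- **[FB] First-bond transfer with constant `C`**: `∃ N₂ ∀ N ≥ N₂` (`N ≥ 3`), for every response density, tap scores and depth-two coefficients:
`|½ − τ₁| ≤ C·√(T³‖g₀‖²)` and `|½ + τ_{N−2}| ≤ C·√(T³‖g_{N−1}‖²)` — the first-order drop over the first bond is controlled by the hot tap score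
(Cauchy–Schwarz shadow of the bracket identity `(τ₁ − ½)/T = ⟨Ψ, g₀⟩₀`, `Ψ` local; `C = sup_N ‖Ψ‖/√T`).  `N`-UNIFORM · UNDECIDED · ATTACKABLE ·
INSTRUMENTABLE · harmonic-TRUE (ratio `≤ 0.70`). [crux of the line · N-uniform] -/
def FirstBondTransferAt (ω₂ lam β γ T C : ℝ) : Prop :=
  ∃ N₂ : ℕ, ∀ N : ℕ, N₂ ≤ N → ∀ (_hN : 3 ≤ N), ∀ h g₀ g₁ : PhaseSpace N → ℝ, ∀ τ τ' : ℝ,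
    IsResponseDensityAt ω₂ lam β γ T N h →
    IsTapScoreAt ω₂ lam β γ T N ⟨0, by omega⟩ (1 / (2 * T ^ 2)) h g₀ →
    IsTapScoreAt ω₂ lam β γ T N ⟨N - 1, by omega⟩ (-(1 / (2 * T ^ 2))) h g₁ →
    IsMomentCoefficientAt ω₂ lam β γ T N ⟨1, by omega⟩ τ →
    IsMomentCoefficientAt ω₂ lam β γ T N ⟨N - 1 - 1, by omega⟩ τ' →
      |1 / 2 - τ| ≤ C * Real.sqrt (T ^ 3 * ∫ x, g₀ x ^ 2 ∂((pinnedChain ω₂ lam β γ).gibbsMeasure N T)) ∧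
      |1 / 2 + τ'| ≤ C * Real.sqrt (T ^ 3 * ∫ x, g₁ x ^ 2 ∂((pinnedChain ω₂ lam β γ).gibbsMeasure N T))

/-! ## D. Composition: the line proves `RootThermalisation 1`; global pieces; the door by name -/

/-- **THE LINE, per temperature: `(∀ N, RR_N) ∧ (∀ N, EP_N) ∧ FB(C) ⟹ RootThermalisationAt … (max C 0) 1`.** [this file · composition] -/
theorem rootThermalisationAt_one_of_transfer {ω₂ lam β γ T C : ℝ} (hT : 0 < T)
    (hR : ∀ N : ℕ, ResponseRegularityAt ω₂ lam β γ T N) (hE : ∀ N : ℕ, EntropyProductionAt ω₂ lam β γ T N)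
    (hF : FirstBondTransferAt ω₂ lam β γ T C) : RootThermalisationAt ω₂ lam β γ T (max C 0) 1 := by
  obtain ⟨N₂, hF'⟩ := hF
  refine ⟨max N₂ 3, fun N hN _h1 ε hε => ?_⟩
  have hN₂ : N₂ ≤ N := le_trans (le_max_left _ _) hN
  have hN3 : 3 ≤ N := le_trans (le_max_right _ _) hN
  obtain ⟨h, g₀, g₁, τ, τ', hh, hg₀, hg₁, hτ, hτ'⟩ := hR N hN3
  have hEP := hE N (by omega) h g₀ g₁ hh hg₀ hg₁
  obtain ⟨hb₀, hb₁⟩ := hF' N hN₂ hN3 h g₀ g₁ τ τ' hh hg₀ hg₁ hτ hτ'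
  set E := escapeDeficit ω₂ lam β γ T N with hE_def
  set I₀ := ∫ x, g₀ x ^ 2 ∂((pinnedChain ω₂ lam β γ).gibbsMeasure N T) with hI₀_def
  set I₁ := ∫ x, g₁ x ^ 2 ∂((pinnedChain ω₂ lam β γ).gibbsMeasure N T) with hI₁_def
  have hI₀ : 0 ≤ I₀ := integral_nonneg fun x => sq_nonneg _
  have hI₁ : 0 ≤ I₁ := integral_nonneg fun x => sq_nonneg _
  have hC : 0 ≤ max C 0 := le_max_right _ _
  set K := max C 0 * Real.sqrt E with hK_def
  have hk₀ : |1 / 2 - τ| ≤ K := by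
    have hT3 : 0 ≤ T ^ 3 := by positivity
    have hs : Real.sqrt (T ^ 3 * I₀) ≤ Real.sqrt E := Real.sqrt_le_sqrt (by nlinarith [mul_nonneg hT3 hI₁])
    calc |1 / 2 - τ| ≤ C * Real.sqrt (T ^ 3 * I₀) := hb₀
      _ ≤ max C 0 * Real.sqrt (T ^ 3 * I₀) := mul_le_mul_of_nonneg_right (le_max_left _ _) (Real.sqrt_nonneg _)
      _ ≤ K := mul_le_mul_of_nonneg_left hs hC
  have hk₁ : |1 / 2 + τ'| ≤ K := by
    have hT3 : 0 ≤ T ^ 3 := by positivity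
    have hs : Real.sqrt (T ^ 3 * I₁) ≤ Real.sqrt E := Real.sqrt_le_sqrt (by nlinarith [mul_nonneg hT3 hI₀])
    calc |1 / 2 + τ'| ≤ C * Real.sqrt (T ^ 3 * I₁) := hb₁
      _ ≤ max C 0 * Real.sqrt (T ^ 3 * I₁) := mul_le_mul_of_nonneg_right (le_max_left _ _) (Real.sqrt_nonneg _)
      _ ≤ K := mul_le_mul_of_nonneg_left hs hC
  have hK : 0 ≤ K := mul_nonneg hC (Real.sqrt_nonneg _)
  obtain ⟨δ₀, hδ₀, hδ₀'⟩ := hτ ε hε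
  obtain ⟨δ₁, hδ₁, hδ₁'⟩ := hτ' ε hε
  refine ⟨min δ₀ δ₁, lt_min hδ₀ hδ₁, fun δ hδ hδlt μ hμ => ?_⟩
  have e₀ := abs_le.1 (hδ₀' δ hδ (lt_of_lt_of_le hδlt (min_le_left _ _)) μ hμ)
  have e₁ := abs_le.1 (hδ₁' δ hδ (lt_of_lt_of_le hδlt (min_le_right _ _)) μ hμ)
  have a₀ := abs_le.1 hk₀
  have a₁ := abs_le.1 hk₁
  have m₁ : δ * (1 / 2 - τ) ≤ δ * K := mul_le_mul_of_nonneg_left a₀.2 hδ.le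
  have m₂ : δ * -K ≤ δ * (1 / 2 - τ) := mul_le_mul_of_nonneg_left a₀.1 hδ.le
  have m₃ : δ * (1 / 2 + τ') ≤ δ * K := mul_le_mul_of_nonneg_left a₁.2 hδ.le
  have m₄ : δ * -K ≤ δ * (1 / 2 + τ') := mul_le_mul_of_nonneg_left a₁.1 hδ.le
  constructor
  · rw [abs_le]; constructor <;> linarith [e₀.1, e₀.2]
  · rw [abs_le]; constructor <;> linarith [e₁.1, e₁.2]

/-- **[RR] global:** for all parameters, `T > 0` and `N`, `ResponseRegularityAt … N`. [support · known · fixed N] -/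
def ResponseRegularity : Prop :=
  ∀ ω₂ lam β γ : ℝ, 0 < ω₂ → 0 < lam → 0 < β → 0 < γ → ∀ T : ℝ, 0 < T → ∀ N : ℕ, ResponseRegularityAt ω₂ lam β γ T N

/-- **[EP] global:** for all parameters, `T > 0` and `N`, `EntropyProductionAt … N`. [support · known · fixed N] -/
def FirstOrderEntropyProduction : Prop :=
  ∀ ω₂ lam β γ : ℝ, 0 < ω₂ → 0 < lam → 0 < β → 0 < γ → ∀ T : ℝ, 0 < T → ∀ N : ℕ, EntropyProductionAt ω₂ lam β γ T N

/-- **[FB] global:** for all parameters and `T > 0` there is `C` with `FirstBondTransferAt … C`. [crux of the line · N-uniform] -/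
def FirstBondTransfer : Prop :=
  ∀ ω₂ lam β γ : ℝ, 0 < ω₂ → 0 < lam → 0 < β → 0 < γ → ∀ T : ℝ, 0 < T → ∃ C : ℝ, FirstBondTransferAt ω₂ lam β γ T C

/-- **THE LINE: `ResponseRegularity ∧ FirstOrderEntropyProduction ∧ FirstBondTransfer ⟹ RootThermalisation 1`.** [this file · composition] -/
theorem rootThermalisation_one_of_transfer (hR : ResponseRegularity) (hE : FirstOrderEntropyProduction) (hF : FirstBondTransfer) :
    RootThermalisation 1 := fun ω₂ lam β γ hω hl hβ hγ T hT => by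
  obtain ⟨C, hC⟩ := hF ω₂ lam β γ hω hl hβ hγ T hT
  exact ⟨max C 0, rootThermalisationAt_one_of_transfer hT (hR ω₂ lam β γ hω hl hβ hγ T hT) (hE ω₂ lam β γ hω hl hβ hγ T hT) hC⟩

/-- `… ⟹ RootPositivity 1` — the contact leaf [RP_1] of the node of record (file 18b). [this file · composition] -/
theorem rootPositivity_one_of_transfer (hR : ResponseRegularity) (hE : FirstOrderEntropyProduction) (hF : FirstBondTransfer) :
    RootPositivity 1 :=
  rootPositivity_of_rootThermalisation (rootThermalisation_one_of_transfer hR hE hF)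

/-- **The door with the contact leaf replaced by the line:
`(∀ ρ < 1, PeeledLocalityLaw ρ 1) ∧ RR ∧ EP ∧ FB ∧ EscapeInfZero ⟹ AsymptoticSeriesLaw`.** [frame] -/
theorem asymptoticSeriesLaw_of_transfer_of_peeled_of_escapeInfZero (hL : ∀ ρ : ℝ, ρ < 1 → PeeledLocalityLaw ρ 1)
    (hR : ResponseRegularity) (hE : FirstOrderEntropyProduction) (hF : FirstBondTransfer) (hI : EscapeInfZero) : AsymptoticSeriesLaw :=
  asymptoticSeriesLaw_of_rootPeeled_of_escapeInfZero hL (rootPositivity_one_of_transfer hR hE hF) hI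

/-- **11071 BY NAME: `(∀ ρ < 1, PeeledLocalityLaw ρ 1) ∧ RR ∧ EP ∧ FB ∧ EscapeInfZero ∧ SubOhmicBootstrap ⟹ BoundedResponse`.** [frame] -/
theorem boundedResponse_of_transfer_of_peeled_of_escapeInfZero_of_subOhmicBootstrap (hL : ∀ ρ : ℝ, ρ < 1 → PeeledLocalityLaw ρ 1)
    (hR : ResponseRegularity) (hE : FirstOrderEntropyProduction) (hF : FirstBondTransfer) (hI : EscapeInfZero) (hB : SubOhmicBootstrap) :
    BoundedResponse :=
  boundedResponse_of_rootPeeled_of_escapeInfZero_of_subOhmicBootstrap hL (rootPositivity_one_of_transfer hR hE hF) hI hB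

/-- The same with the floor partner named as the route item `NonBallistic` (stmt-9127). [frame] -/
theorem asymptoticSeriesLaw_of_transfer_of_peeled_of_nonBallistic (hL : ∀ ρ : ℝ, ρ < 1 → PeeledLocalityLaw ρ 1)
    (hR : ResponseRegularity) (hE : FirstOrderEntropyProduction) (hF : FirstBondTransfer) (hN : NonBallistic) : AsymptoticSeriesLaw :=
  asymptoticSeriesLaw_of_transfer_of_peeled_of_escapeInfZero hL hR hE hF (escapeInfZero_iff_nonBallistic.2 hN)

end EscapeGrading

end Summit.AtomisticToContinuum.FouriersLaw.Theorems.SubdiffusiveBondHeat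

end
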